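import Literature.Algebra.Lie.KatzRecognitionTheorems
import Literature.Algebra.Lie.SymplecticSymmetricSquares
import HarnessLib

/-!
# BL, case (b): the bracket `[s_{u v₊}, s_{w v₋}]` is Gabber's diagonal `Diag(1, 1, 0, …, 0, −1, −1)`
(the hypothesis shape `ContainsDiagonal` of Katz's Theorem 1.4, *ESDE* Ch. 1 p. 10)

Setting: `ω` alternating on `M`, a hyperbolic pair `v₊, v₋` (`ω(v₊, v₋) = 1`) and `u, w ∈ U = ⟨v₊, v₋⟩^⊥` with `ω(u, w) = c ≠ 0`.
The operator `H := [s_{u v₊}, s_{w v₋}] = −s_{uw} − c·s_{v₊ v₋}` acts by `−c` on `v₊, u`, by `+c` on `v₋, w`, and by `0` on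
`U′ = ⟨v₊, v₋, u, w⟩^⊥` (`gabber_apply_*`). In the basis `(v₊, u, basis of U′, v₋, w)` the operator `−c⁻¹ H` has matrix
`Diag(1, 1, 0, …, 0, −1, −1)`; hence **`containsDiagonal_gabber`**: a subspace `L ∋ s_{u v₊}, s_{w v₋}` closed under the bracket of
these two satisfies `KatzRecognition.ContainsDiagonal L (Gabber pattern on Fin (2 + (m + 2)))`, `m = dim U′`, and
`finrank M = 2 + (m + 2)`. Pure linear algebra; for the Hodge cell's crux K1Q (lemma BL feeding `Katz1990_thm14_gabber_of_ne`,
`Katz1990_thm14_gabber_dim8`, `Katz1990_rmk141_nonsimple`). [cite: Katz1990ESDE, Ch. 1, Thm. 1.4 (p. 10)]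
-/

namespace Literature.Algebra.Lie

-- Mathlib's own non-instance `def` for the commutator bracket on an associative ring, enabled LOCALLY exactly as
-- `Mathlib.Algebra.Lie.SkewAdjoint` and the tree's `KatzRecognitionTheorems` do.
attribute [local instance 100] LieRing.ofAssociativeRing

namespace GabberDiagonal

open Module KatzRecognition SymplecticSymmetricSquares
open LinearMap (BilinForm)

variable {K : Type*} [Field K] {V : Type*} [AddCommGroup V] [Module K V]

section Operator

variable {ω : BilinForm K V} (hω : ω.IsAlt) {vp vm u w : V} (hpm : ω vp vm = 1) (hup : ω u vp = 0) (hum : ω u vm = 0)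
  (hwp : ω w vp = 0) (hwm : ω w vm = 0)

/-- Gabber's operator `H = [s_{u v₊}, s_{w v₋}] = −s_{uw} − ω(u,w) s_{v₊v₋}`. [cite: Katz1990ESDE, Ch. 1, Thm. 1.4 (p. 10)] -/
def gabber (ω : BilinForm K V) (vp vm u w : V) : Module.End K V :=
  symSq ω u vp * symSq ω w vm - symSq ω w vm * symSq ω u vp

include hω hpm hum hwp in
/-- `H = −s_{uw} − ω(u,w) s_{v₊ v₋}`. [cite: Katz1990ESDE, Ch. 1, Thm. 1.4 (p. 10)] -/
theorem gabber_eq : gabber ω vp vm u w = -symSq ω u w - ω u w • symSq ω vp vm := by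
  rw [gabber, symSq_commutator hω]
  have h1 : ω vm u = 0 := by rw [← LinearMap.IsAlt.neg hω u vm, hum, neg_zero]
  have h2 : ω vm vp = -1 := by rw [← LinearMap.IsAlt.neg hω vp vm, hpm]
  have h3 : ω w u = -ω u w := by rw [← LinearMap.IsAlt.neg hω u w]
  rw [h1, h2, h3, hwp]
  module

include hω hpm hup hum hwp in
/-- `H v₊ = −ω(u,w) v₊`. [cite: Katz1990ESDE, Ch. 1, Thm. 1.4 (p. 10)] -/
theorem gabber_apply_vp : gabber ω vp vm u w vp = -(ω u w • vp) := by
  rw [gabber_eq hω hpm hum hwp]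
  have h1 : ω vp u = 0 := by rw [← LinearMap.IsAlt.neg hω u vp, hup, neg_zero]
  have h2 : ω vp w = 0 := by rw [← LinearMap.IsAlt.neg hω w vp, hwp, neg_zero]
  simp only [LinearMap.sub_apply, LinearMap.neg_apply, LinearMap.smul_apply, symSq_apply, h1, h2, hω vp, hpm, zero_smul,
    add_zero, neg_zero, one_smul, zero_add, zero_sub]

include hω hpm hum hwp hwm in
/-- `H v₋ = ω(u,w) v₋`. [cite: Katz1990ESDE, Ch. 1, Thm. 1.4 (p. 10)] -/
theorem gabber_apply_vm : gabber ω vp vm u w vm = ω u w • vm := by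
  rw [gabber_eq hω hpm hum hwp]
  have h1 : ω vm u = 0 := by rw [← LinearMap.IsAlt.neg hω u vm, hum, neg_zero]
  have h2 : ω vm w = 0 := by rw [← LinearMap.IsAlt.neg hω w vm, hwm, neg_zero]
  have h3 : ω vm vp = -1 := by rw [← LinearMap.IsAlt.neg hω vp vm, hpm]
  simp only [LinearMap.sub_apply, LinearMap.neg_apply, LinearMap.smul_apply, symSq_apply, h1, h2, h3, hω vm, zero_smul,
    add_zero, neg_zero, neg_one_smul, smul_neg, zero_sub, neg_neg]

include hω hpm hup hum hwp in
/-- `H u = −ω(u,w) u`. [cite: Katz1990ESDE, Ch. 1, Thm. 1.4 (p. 10)] -/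
theorem gabber_apply_u : gabber ω vp vm u w u = -(ω u w • u) := by
  rw [gabber_eq hω hpm hum hwp]
  simp only [LinearMap.sub_apply, LinearMap.neg_apply, LinearMap.smul_apply, symSq_apply, hω u, hup, hum, zero_smul,
    zero_add, add_zero, smul_zero, sub_zero]

include hω hpm hum hwp hwm in
/-- `H w = ω(u,w) w`. [cite: Katz1990ESDE, Ch. 1, Thm. 1.4 (p. 10)] -/
theorem gabber_apply_w : gabber ω vp vm u w w = ω u w • w := by
  rw [gabber_eq hω hpm hum hwp]
  have h3 : ω w u = -ω u w := by rw [← LinearMap.IsAlt.neg hω u w]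
  simp only [LinearMap.sub_apply, LinearMap.neg_apply, LinearMap.smul_apply, symSq_apply, hω w, h3, hwp, hwm, zero_smul,
    add_zero, smul_zero, sub_zero, neg_smul, neg_neg]

include hω hpm hum hwp in
/-- `H z = 0` for `z ⊥ v₊, v₋, u, w`. [cite: Katz1990ESDE, Ch. 1, Thm. 1.4 (p. 10)] -/
theorem gabber_apply_of_orthogonal {z : V} (hzp : ω z vp = 0) (hzm : ω z vm = 0) (hzu : ω z u = 0) (hzw : ω z w = 0) :
    gabber ω vp vm u w z = 0 := by
  rw [gabber_eq hω hpm hum hwp]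
  simp only [LinearMap.sub_apply, LinearMap.neg_apply, LinearMap.smul_apply, symSq_apply, hzp, hzm, hzu, hzw, zero_smul,
    add_zero, smul_zero, neg_zero, sub_zero]

end Operator

/-! ## The adapted basis `(v₊, u, basis of U′, v₋, w)` and the diagonal matrix -/

section Basis

variable [FiniteDimensional K V] {ω : BilinForm K V} (hω : ω.IsAlt) {vp vm u w : V} (hpm : ω vp vm = 1) (hup : ω u vp = 0)
  (hum : ω u vm = 0) (hwp : ω w vp = 0) (hwm : ω w vm = 0) (huw : ω u w ≠ 0)

/-- The common orthogonal `U′ = ⟨v₊, v₋, u, w⟩^⊥`. [cite: Katz1990ESDE, Ch. 1, Thm. 1.4 (p. 10)] -/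
def orth (ω : BilinForm K V) (vp vm u w : V) : Submodule K V :=
  (LinearMap.ker (ω.flip vp) ⊓ LinearMap.ker (ω.flip vm)) ⊓ (LinearMap.ker (ω.flip u) ⊓ LinearMap.ker (ω.flip w))

omit [FiniteDimensional K V] in
/-- Membership in `U′`. [cite: Katz1990ESDE, Ch. 1, Thm. 1.4 (p. 10)] -/
theorem mem_orth {z : V} : z ∈ orth ω vp vm u w ↔ (ω z vp = 0 ∧ ω z vm = 0) ∧ (ω z u = 0 ∧ ω z w = 0) := by
  simp only [orth, Submodule.mem_inf, LinearMap.mem_ker]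
  rfl

/-- The adapted family on `Fin 2 ⊕ (Fin m ⊕ Fin 2)`: `(v₊, u ; basis of U′ ; v₋, w)`. [cite: Katz1990ESDE, Ch. 1, Thm. 1.4 (p. 10)] -/
noncomputable def family (ω : BilinForm K V) (vp vm u w : V) :
    Fin 2 ⊕ (Fin (finrank K (orth ω vp vm u w)) ⊕ Fin 2) → V
  | Sum.inl i => ![vp, u] i
  | Sum.inr (Sum.inl j) => (finBasis K (orth ω vp vm u w) j : V)
  | Sum.inr (Sum.inr i) => ![vm, w] i

omit [FiniteDimensional K V] in
include hω hpm hup hum hwp hwm huw in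
/-- Every vector decomposes along `v₊, v₋, u, w` and `U′`. [cite: Katz1990ESDE, Ch. 1, Thm. 1.4 (p. 10)] -/
theorem sub_mem_orth (z : V) :
    z - (ω z vm • vp - ω z vp • vm + (ω u w)⁻¹ • (ω z w • u - ω z u • w)) ∈ orth ω vp vm u w := by
  have hmp : ω vm vp = -1 := by rw [← LinearMap.IsAlt.neg hω vp vm, hpm]
  have hpu : ω vp u = 0 := by rw [← LinearMap.IsAlt.neg hω u vp, hup, neg_zero]
  have hmu : ω vm u = 0 := by rw [← LinearMap.IsAlt.neg hω u vm, hum, neg_zero]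
  have hpw : ω vp w = 0 := by rw [← LinearMap.IsAlt.neg hω w vp, hwp, neg_zero]
  have hmw : ω vm w = 0 := by rw [← LinearMap.IsAlt.neg hω w vm, hwm, neg_zero]
  have hwu : ω w u = -ω u w := by rw [← LinearMap.IsAlt.neg hω u w]
  rw [mem_orth]
  refine ⟨⟨?_, ?_⟩, ?_, ?_⟩ <;>
    simp only [map_sub, map_add, map_smul, LinearMap.sub_apply, LinearMap.add_apply, LinearMap.smul_apply, smul_eq_mul,
      hpm, hmp, hup, hum, hwp, hwm, hpu, hmu, hpw, hmw, hwu, hω vp, hω vm, hω u, hω w] <;>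
    field_simp <;> ring

include hω hpm hup hum hwp hwm huw in
/-- The adapted family spans `M`. [cite: Katz1990ESDE, Ch. 1, Thm. 1.4 (p. 10)] -/
theorem span_family : ⊤ ≤ Submodule.span K (Set.range (family ω vp vm u w)) := by
  intro z _
  set S := Submodule.span K (Set.range (family ω vp vm u w))
  have hvp : vp ∈ S := Submodule.subset_span ⟨Sum.inl 0, by simp [family]⟩
  have hu : u ∈ S := Submodule.subset_span ⟨Sum.inl 1, by simp [family]⟩
  have hvm : vm ∈ S := Submodule.subset_span ⟨Sum.inr (Sum.inr 0), by simp [family]⟩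
  have hw : w ∈ S := Submodule.subset_span ⟨Sum.inr (Sum.inr 1), by simp [family]⟩
  have horth : ∀ y ∈ orth ω vp vm u w, y ∈ S := by
    intro y hy
    have hrepr := (finBasis K (orth ω vp vm u w)).sum_repr ⟨y, hy⟩
    have : y = ∑ j, (finBasis K (orth ω vp vm u w)).repr ⟨y, hy⟩ j • (finBasis K (orth ω vp vm u w) j : V) := by
      have := congrArg Subtype.val hrepr
      simpa only [Submodule.coe_sum, Submodule.coe_smul] using this.symm
    rw [this]
    exact S.sum_mem fun j _ => S.smul_mem _ (Submodule.subset_span ⟨Sum.inr (Sum.inl j), by simp [family]⟩)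
  have hz := horth _ (sub_mem_orth hω hpm hup hum hwp hwm huw z)
  have : z = (z - (ω z vm • vp - ω z vp • vm + (ω u w)⁻¹ • (ω z w • u - ω z u • w))) +
      (ω z vm • vp - ω z vp • vm + (ω u w)⁻¹ • (ω z w • u - ω z u • w)) := by abel
  rw [this]
  exact S.add_mem hz (S.add_mem (S.sub_mem (S.smul_mem _ hvp) (S.smul_mem _ hvm))
    (S.smul_mem _ (S.sub_mem (S.smul_mem _ hu) (S.smul_mem _ hw))))

include hω hpm hup hum hwp hwm huw in
/-- The adapted family is linearly independent. [cite: Katz1990ESDE, Ch. 1, Thm. 1.4 (p. 10)] -/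
theorem linearIndependent_family : LinearIndependent K (family ω vp vm u w) := by
  have hmp : ω vm vp = -1 := by rw [← LinearMap.IsAlt.neg hω vp vm, hpm]
  have hwu : ω w u = -ω u w := by rw [← LinearMap.IsAlt.neg hω u w]
  rw [Fintype.linearIndependent_iff]
  intro g hg
  -- the orthogonal part: basis vectors of `U′` pair to zero with `v₊, v₋, u, w`
  have hb := fun j => mem_orth.1 (finBasis K (orth ω vp vm u w) j).2
  have hb1 : ∀ j, ω (finBasis K (orth ω vp vm u w) j : V) vp = 0 := fun j => (hb j).1.1
  have hb2 : ∀ j, ω (finBasis K (orth ω vp vm u w) j : V) vm = 0 := fun j => (hb j).1.2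
  have hb3 : ∀ j, ω (finBasis K (orth ω vp vm u w) j : V) u = 0 := fun j => (hb j).2.1
  have hb4 : ∀ j, ω (finBasis K (orth ω vp vm u w) j : V) w = 0 := fun j => (hb j).2.2
  have hpu : ω vp u = 0 := by rw [← LinearMap.IsAlt.neg hω u vp, hup, neg_zero]
  have hmu : ω vm u = 0 := by rw [← LinearMap.IsAlt.neg hω u vm, hum, neg_zero]
  have hpw : ω vp w = 0 := by rw [← LinearMap.IsAlt.neg hω w vp, hwp, neg_zero]
  have hmw : ω vm w = 0 := by rw [← LinearMap.IsAlt.neg hω w vm, hwm, neg_zero]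
  simp only [Fintype.sum_sum_type, Fin.sum_univ_two, family, Matrix.cons_val_zero, Matrix.cons_val_one] at hg
  -- pair with `v₋`, `v₊`, `w`, `u`
  have e1 := congrArg (fun z => ω z vm) hg
  have e2 := congrArg (fun z => ω z vp) hg
  have e3 := congrArg (fun z => ω z w) hg
  have e4 := congrArg (fun z => ω z u) hg
  simp only [map_add, map_sum, map_smul, LinearMap.add_apply, LinearMap.sum_apply, LinearMap.smul_apply, smul_eq_mul, hpm, hmp,
    hup, hum, hwp, hwm, hwu, hpu, hmu, hpw, hmw, hω vp, hω vm, hω u, hω w, hb1, hb2, hb3, hb4, mul_zero, mul_one, mul_neg,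
    neg_eq_zero, Finset.sum_const_zero, add_zero, zero_add, map_zero, LinearMap.zero_apply] at e1 e2 e3 e4
  have g0 : g (Sum.inl 0) = 0 := e1
  have g3 : g (Sum.inr (Sum.inr 0)) = 0 := e2
  have g1 : g (Sum.inl 1) = 0 := (mul_eq_zero.1 e3).resolve_right huw
  have g4 : g (Sum.inr (Sum.inr 1)) = 0 := (mul_eq_zero.1 e4).resolve_right huw
  -- the middle coefficients by independence of the basis of `U′`
  simp only [g0, g1, g3, g4, zero_smul, zero_add, add_zero] at hg
  have hmid : ∀ j, g (Sum.inr (Sum.inl j)) = 0 := by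
    have hli := (finBasis K (orth ω vp vm u w)).linearIndependent
    rw [Fintype.linearIndependent_iff] at hli
    refine hli _ ?_
    apply Subtype.ext
    simpa only [Submodule.coe_sum, Submodule.coe_smul, Submodule.coe_zero] using hg
  rintro (i | (j | i))
  · fin_cases i
    · exact g0
    · exact g1
  · exact hmid j
  · fin_cases i
    · exact g3
    · exact g4

/-- The order-preserving reindexing `Fin 2 ⊕ (Fin m ⊕ Fin 2) ≃ Fin (2 + (m + 2))`. [cite: Katz1990ESDE, Ch. 1, Thm. 1.4 (p. 10)] -/
def reindexEquiv (m : ℕ) : Fin 2 ⊕ (Fin m ⊕ Fin 2) ≃ Fin (2 + (m + 2)) :=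
  (Equiv.sumCongr (Equiv.refl (Fin 2)) finSumFinEquiv).trans finSumFinEquiv

omit [FiniteDimensional K V] in
/-- Values of the reindexing: `inl i ↦ i`. [cite: Katz1990ESDE, Ch. 1, Thm. 1.4 (p. 10)] -/
theorem reindexEquiv_inl (m : ℕ) (i : Fin 2) : ((reindexEquiv m (Sum.inl i) : Fin _) : ℕ) = i := by
  simp [reindexEquiv]

omit [FiniteDimensional K V] in
/-- Values of the reindexing: `inr (inl j) ↦ 2 + j`. [cite: Katz1990ESDE, Ch. 1, Thm. 1.4 (p. 10)] -/
theorem reindexEquiv_inr_inl (m : ℕ) (j : Fin m) : ((reindexEquiv m (Sum.inr (Sum.inl j)) : Fin _) : ℕ) = 2 + j := by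
  simp [reindexEquiv]

omit [FiniteDimensional K V] in
/-- Values of the reindexing: `inr (inr i) ↦ 2 + (m + i)`. [cite: Katz1990ESDE, Ch. 1, Thm. 1.4 (p. 10)] -/
theorem reindexEquiv_inr_inr (m : ℕ) (i : Fin 2) : ((reindexEquiv m (Sum.inr (Sum.inr i)) : Fin _) : ℕ) = 2 + (m + i) := by
  simp [reindexEquiv]

/-- The adapted basis, reindexed by `Fin (2 + (m + 2))` in the order `(v₊, u, U′…, v₋, w)`. [cite: Katz1990ESDE, Ch. 1, Thm. 1.4 (p. 10)] -/
noncomputable def adaptedBasis (hω : ω.IsAlt) (hpm : ω vp vm = 1) (hup : ω u vp = 0) (hum : ω u vm = 0) (hwp : ω w vp = 0)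
    (hwm : ω w vm = 0) (huw : ω u w ≠ 0) : Basis (Fin (2 + (finrank K (orth ω vp vm u w) + 2))) K V :=
  (Basis.mk (linearIndependent_family hω hpm hup hum hwp hwm huw) (span_family hω hpm hup hum hwp hwm huw)).reindex
    (reindexEquiv _)

include hω hpm hup hum hwp hwm huw in
/-- The adapted basis on the sum-type index. [cite: Katz1990ESDE, Ch. 1, Thm. 1.4 (p. 10)] -/
theorem adaptedBasis_apply (x : Fin 2 ⊕ (Fin (finrank K (orth ω vp vm u w)) ⊕ Fin 2)) :
    adaptedBasis hω hpm hup hum hwp hwm huw (reindexEquiv _ x) = family ω vp vm u w x := by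
  rw [adaptedBasis, Basis.reindex_apply, Equiv.symm_apply_apply, Basis.mk_apply]

/-- Gabber's diagonal pattern `(1, 1, 0, …, 0, −1, −1)` on `Fin n` (as in `Katz1990_thm14_gabber_of_ne`).
[cite: Katz1990ESDE, Ch. 1, Thm. 1.4 (p. 10)] -/
def gabberPattern (K : Type*) [Field K] (n : ℕ) : Fin n → K :=
  fun i => if (i : ℕ) < 2 then (1 : K) else if n - 2 ≤ (i : ℕ) then (-1 : K) else 0

include hω hpm hup hum hwp hwm huw in
/-- `−ω(u,w)⁻¹ H` acts on the adapted basis by Gabber's pattern. [cite: Katz1990ESDE, Ch. 1, Thm. 1.4 (p. 10)] -/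
theorem smul_gabber_apply_adaptedBasis (i : Fin (2 + (finrank K (orth ω vp vm u w) + 2))) :
    ((-(ω u w)⁻¹) • gabber ω vp vm u w) (adaptedBasis hω hpm hup hum hwp hwm huw i) =
      gabberPattern K _ i • adaptedBasis hω hpm hup hum hwp hwm huw i := by
  obtain ⟨x, rfl⟩ := (reindexEquiv (finrank K (orth ω vp vm u w))).surjective i
  rw [adaptedBasis_apply]
  rcases x with i | (j | i)
  · -- `v₊`, `u`: eigenvalue `1`
    have hlt : ((reindexEquiv (finrank K (orth ω vp vm u w)) (Sum.inl i) : Fin _) : ℕ) < 2 := by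
      rw [reindexEquiv_inl]; exact i.2
    rw [gabberPattern, if_pos hlt, one_smul, LinearMap.smul_apply]
    fin_cases i
    · simp only [family, Fin.zero_eta, Matrix.cons_val_zero]
      rw [gabber_apply_vp hω hpm hup hum hwp, smul_neg, smul_smul, neg_mul, inv_mul_cancel₀ huw, neg_smul, one_smul, neg_neg]
    · simp only [family, Fin.mk_one, Matrix.cons_val_one, Matrix.cons_val_zero]
      rw [gabber_apply_u hω hpm hup hum hwp, smul_neg, smul_smul, neg_mul, inv_mul_cancel₀ huw, neg_smul, one_smul, neg_neg]
  · -- `U′`: eigenvalue `0`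
    have hb := mem_orth.1 (finBasis K (orth ω vp vm u w) j).2
    have h1 : ¬ (((reindexEquiv (finrank K (orth ω vp vm u w)) (Sum.inr (Sum.inl j)) : Fin _) : ℕ) < 2) := by
      rw [reindexEquiv_inr_inl]; omega
    have h2 : ¬ (2 + (finrank K (orth ω vp vm u w) + 2) - 2 ≤
        ((reindexEquiv (finrank K (orth ω vp vm u w)) (Sum.inr (Sum.inl j)) : Fin _) : ℕ)) := by
      rw [reindexEquiv_inr_inl]; have := j.2; omega
    rw [gabberPattern, if_neg h1, if_neg h2, zero_smul, LinearMap.smul_apply]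
    simp only [family]
    rw [gabber_apply_of_orthogonal hω hpm hum hwp hb.1.1 hb.1.2 hb.2.1 hb.2.2, smul_zero]
  · -- `v₋`, `w`: eigenvalue `−1`
    have h1 : ¬ (((reindexEquiv (finrank K (orth ω vp vm u w)) (Sum.inr (Sum.inr i)) : Fin _) : ℕ) < 2) := by
      rw [reindexEquiv_inr_inr]; omega
    have h2 : 2 + (finrank K (orth ω vp vm u w) + 2) - 2 ≤
        ((reindexEquiv (finrank K (orth ω vp vm u w)) (Sum.inr (Sum.inr i)) : Fin _) : ℕ) := by
      rw [reindexEquiv_inr_inr]; omega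
    rw [gabberPattern, if_neg h1, if_pos h2, LinearMap.smul_apply, neg_one_smul]
    fin_cases i
    · simp only [family, Fin.zero_eta, Matrix.cons_val_zero]
      rw [gabber_apply_vm hω hpm hum hwp hwm, smul_smul, neg_mul, inv_mul_cancel₀ huw, neg_one_smul]
    · simp only [family, Fin.mk_one, Matrix.cons_val_one, Matrix.cons_val_zero]
      rw [gabber_apply_w hω hpm hum hwp hwm, smul_smul, neg_mul, inv_mul_cancel₀ huw, neg_one_smul]

include hω hpm hup hum hwp hwm huw in
/-- **`ContainsDiagonal` for Gabber's operator**: a subspace `L ∋ [s_{u v₊}, s_{w v₋}]` contains, in the adapted basis, the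
diagonal matrix `Diag(1, 1, 0, …, 0, −1, −1)`. [cite: Katz1990ESDE, Ch. 1, Thm. 1.4 (p. 10)] -/
theorem containsDiagonal_of_gabber_mem (L : LieSubalgebra K (Module.End K V)) (hH : gabber ω vp vm u w ∈ L) :
    ContainsDiagonal L (gabberPattern K (2 + (finrank K (orth ω vp vm u w) + 2))) := by
  refine ⟨adaptedBasis hω hpm hup hum hwp hwm huw, (-(ω u w)⁻¹) • gabber ω vp vm u w, L.smul_mem _ hH, ?_⟩
  ext i j
  rw [LinearMap.toMatrix_apply, smul_gabber_apply_adaptedBasis hω hpm hup hum hwp hwm huw, map_smul, Basis.repr_self,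
    Matrix.diagonal_apply, Finsupp.smul_apply, Finsupp.single_apply, smul_eq_mul]
  by_cases h : i = j
  · subst h; simp
  · rw [if_neg (Ne.symm h), if_neg h, mul_zero]

include hω hpm hup hum hwp hwm huw in
/-- The dimension count `dim M = 2 + (dim U′ + 2)`. [cite: Katz1990ESDE, Ch. 1, Thm. 1.4 (p. 10)] -/
theorem finrank_eq : finrank K V = 2 + (finrank K (orth ω vp vm u w) + 2) := by
  simpa using finrank_eq_card_basis (adaptedBasis hω hpm hup hum hwp hwm huw)

end Basis

end GabberDiagonal

end Literature.Algebra.Lie
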